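import Literature.NumberTheory.LFunctions.Zhang2022.SkeletonPartOne
import Literature.NumberTheory.LFunctions.Zhang2022.Section3Lemma36
import Literature.NumberTheory.LFunctions.Zhang2022.Section2FrakP
import HarnessLib

/-!
# Zhang (2022), skeleton node `Lemma35` DISCHARGED: Lemma 3.5 holds (DAG node `Z22:Lem3.5`)

Topic `Literature/NumberTheory/LFunctions/Zhang2022` (Landau–Siegel audit tree; verdict-neutral).
Y. Zhang, *Discrete mean estimates and the Landau–Siegel zero*, arXiv:2211.02515v1 (2022)
[Zhang2022LandauSiegel] — **an unrefereed manuscript under adjudication** — §3, Lemma 3.5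
[Z22 p.15, tex L835–L846] (D-0069 campaign DAG node `Z22:Lem3.5`, discharge row D18, cone C02):

> Write `X₃(x,ψ) = ∑_{D⁴<n≤x} ν(n)ψ(n)n^{−s₀}` for `x > D⁴`. Assume that (A) holds. By Cauchy's
> inequality, the second assertion of Lemma 3.2 [sic: Lemma 3.3] and Lemma 3.1,
> `∑_{ψ∈Ψ} (|X₃(P²,ψ)| + ∫_{D⁴}^{P²} |X₃(x,ψ)| dx/x)² ≪ P²𝓛⁻¹⁹⁹³ ≪ 𝔓𝓛⁻¹⁹⁰⁹`. Thus we conclude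
> **Lemma 3.5.** Assume that (A) holds. The inequality
> `|X₃(P²,ψ)| + ∫_{D⁴}^{P²} |X₃(x,ψ)| dx/x < 𝓛⁻⁵⁸⁵`  (3.5)
> holds for all but at most `O(𝔓𝓛⁻⁷³⁹)` characters `ψ` in `Ψ`.

The typed skeleton states Lemma 3.5 as the CLAIM `Skeleton.Lemma35` (`SkeletonPartOne`, a leaf of
`Skeleton.theorem1_of_leaves`). This file PROVES it along the printed route, from tree theorems:

1. `twist36_meanSquare_le_largeSieve`, `moment35_le` — the generic second moment of
   `|S(⌊b⌋,ψ)| + ∫_A^b |S(⌊x⌋,ψ)| dx/x` over the primitive characters to moduli `M ⊆ [1,Q]`, for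
   `S(N,ψ) = ∑_{A<n≤N} a(n)ψ(n)n^{−s}` (`Lemma36.twist36`): `≤ (2 + 2log²(b/A))(⌊b⌋ + 1 + 2Q²)
   ∑_{A<n≤⌊b⌋} |a(n)|²n^{−2σ}` — word for word the tree's `Lemma36.moment36_le` (orthogonality,
   `Section3Lemma36`) with the LARGE SIEVE (Lemma 3.3 (ii), `weighted_largeSieve_meanValue`,
   `Section3MeanValues`) in place of orthogonality (here `N = P²` exceeds the moduli `p ∼ P`), the
   Cauchy–Schwarz step `Lemma36.sq_integral_div_le_log_mul_integral` and a real upper endpoint `b`;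
2. the sizes of §2: `p ∼ P ⇒ 1 ≤ p ≤ Q := ⌈P(1+𝓛⁻⁶⁸)⌉`, `⌊P²⌋ + 1 + 2Q² ≤ 20P²`,
   `2 + 2log²(P²/D⁴) ≤ 9𝓛¹⁸`, and `P² ≤ 2𝔓𝓛⁷⁷` from the tree's PROVED (2.9)
   `Zhang2022.frakP_bounds` (`|𝔓 − P²𝓛⁻⁷⁷| ≤ 3𝓛⁻⁶⁸P²𝓛⁻⁷⁷`);
3. **`lemma35_holds : Skeleton.Lemma35`** — with Lemma 3.1 (`Lemma31.lemma_3_1`, a tree theorem: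
   `∑_{D⁴<n≤N} |ν(n)|²/n ≤ C₁𝓛⁻²⁰¹¹` for `N ≤ P²` under (A)) the moment is
   `≤ 9𝓛¹⁸·20P²·C₁𝓛⁻²⁰¹¹ = 180C₁P²𝓛⁻¹⁹⁹³ ≤ 360C₁𝔓𝓛⁻¹⁹¹⁶` (printed: `≪ P²𝓛⁻¹⁹⁹³ ≪ 𝔓𝓛⁻¹⁹⁰⁹`),
   and Chebyshev at `V = 𝓛⁻⁵⁸⁵` (`Lemma36.sum_card_filter_le_of_moment36`) leaves at most
   `360C₁𝔓𝓛⁻⁷⁴⁶ ≤ 360C₁𝔓𝓛⁻⁷³⁹` exceptional `ψ ∈ Ψ` (the exceptional set embeds in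
   `Σ_{p∼P} {ψ mod p primitive : lhs ≥ 𝓛⁻⁵⁸⁵}` exactly as in `Section3Lemma36Holds`).

No new definitions, no new facts. WHAT THIS IS NOT: any statement about Theorems 1–2 of the
manuscript or about Landau–Siegel zeros; the cell verdict (gap at (8.24)) is untouched.

## References

* Y. Zhang, arXiv:2211.02515v1 (2022), §3 Lemmas 3.1, 3.3, 3.5, p. 15; §2 (2.6), (2.9).
  [cite: Zhang2022LandauSiegel, §3 Lemma 3.5]
-/

noncomputable section

open Complex Real Finset MeasureTheory

namespace Literature.NumberTheory.LFunctions.Zhang2022.Skeleton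

open Lemma36 (twist36 intervalIntegrable_natFloor_div sq_integral_div_le_log_mul_integral
  sum_card_filter_le_of_moment36)

/-! ## Layer 1: the generic second moment with the large sieve -/

open scoped Classical in
/-- The large sieve at height `N` (the tree's Lemma 3.3 (ii) `weighted_largeSieve_meanValue` with
the coefficients cut off below `A`): for moduli `M ⊆ [1,Q]`,
`∑_{p∈M} ∑*_{ψ mod p} ‖S(N,ψ)‖² ≤ (N + 1 + 2Q²) ∑_{A<n≤N} ‖a(n)‖² n^{−2 Re s}`.
[cite: Zhang2022LandauSiegel, §3 Lemma 3.3] -/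
theorem twist36_meanSquare_le_largeSieve (a : ℕ → ℂ) (A : ℕ) (s : ℂ) (N Q : ℕ) (M : Finset ℕ)
    (hM : M ⊆ Icc 1 Q) :
    ∑ p ∈ M, ∑ ψ : DirichletCharacter ℂ p with ψ.IsPrimitive, ‖twist36 a A s ψ N‖ ^ 2 ≤
      ((N : ℝ) + 1 + 2 * (Q : ℝ) ^ 2) * ∑ n ∈ Ioc A N, ‖a n‖ ^ 2 * (n : ℝ) ^ (-(2 * s.re)) := by
  -- adapted from `Lemma36.twist36_meanSquare_le` (orthogonality ↦ large sieve)
  have key := weighted_largeSieve_meanValue M N Q hM (fun n => if A < n then a n else 0) s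
  have hsub : Ioc A N ⊆ Ioc 0 N := Ioc_subset_Ioc (Nat.zero_le A) le_rfl
  have hout : ∀ n ∈ Ioc 0 N, n ∉ Ioc A N → ¬A < n := fun n hn hn' h =>
    hn' (mem_Ioc.mpr ⟨h, (mem_Ioc.mp hn).2⟩)
  have hS : ∀ (p : ℕ) (ψ : DirichletCharacter ℂ p),
      ∑ n ∈ Ioc 0 N, (if A < n then a n else 0) * ψ (n : ZMod p) * (n : ℂ) ^ (-s) =
        twist36 a A s ψ N := by
    intro p ψ
    rw [twist36, ← sum_subset hsub]
    · exact sum_congr rfl fun n hn => by rw [if_pos (mem_Ioc.mp hn).1]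
    · intro n hn hn'
      rw [if_neg (hout n hn hn'), zero_mul, zero_mul]
  have hR : ∑ n ∈ Ioc 0 N, ‖(if A < n then a n else 0)‖ ^ 2 * (n : ℝ) ^ (-(2 * s.re)) =
      ∑ n ∈ Ioc A N, ‖a n‖ ^ 2 * (n : ℝ) ^ (-(2 * s.re)) := by
    rw [← sum_subset hsub]
    · exact sum_congr rfl fun n hn => by rw [if_pos (mem_Ioc.mp hn).1]
    · intro n hn hn'
      rw [if_neg (hout n hn hn'), norm_zero, zero_pow two_ne_zero, zero_mul]
  simp_rw [hS] at key
  rwa [hR] at key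

open scoped Classical in
/-- **The second moment of `|S(⌊b⌋,ψ)| + ∫_A^b |S(⌊x⌋,ψ)| dx/x` over primitive characters, by the
large sieve** (the display preceding Lemma 3.5, in general form): for a natural `A ≥ 1`, a real
`b ≥ A`, moduli `M ⊆ [1,Q]` and any `a`, `s`,
`∑_{p∈M} ∑*_{ψ mod p} (‖S(⌊b⌋,ψ)‖ + ∫_A^b ‖S(⌊x⌋,ψ)‖ dx/x)²
  ≤ (2 + 2log²(b/A)) (⌊b⌋ + 1 + 2Q²) ∑_{A<n≤⌊b⌋} ‖a(n)‖² n^{−2 Re s}`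
(`(u+v)² ≤ 2u² + 2v²`; large sieve at height `⌊b⌋` for `u`; Cauchy–Schwarz in `dx/x` and the
large sieve at every height `⌊x⌋ ≤ ⌊b⌋` under the integral for `v`).
[cite: Zhang2022LandauSiegel, §3 Lemma 3.5] -/
theorem moment35_le (a : ℕ → ℂ) (s : ℂ) {A : ℕ} {b : ℝ} (hA : 0 < A) (hAb : (A : ℝ) ≤ b)
    (Q : ℕ) (M : Finset ℕ) (hM : M ⊆ Icc 1 Q) :
    ∑ p ∈ M, ∑ ψ : DirichletCharacter ℂ p with ψ.IsPrimitive,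
        (‖twist36 a A s ψ ⌊b⌋₊‖ + ∫ x in (A : ℝ)..b, ‖twist36 a A s ψ ⌊x⌋₊‖ / x) ^ 2 ≤
      (2 + 2 * Real.log (b / A) ^ 2) * ((⌊b⌋₊ : ℝ) + 1 + 2 * (Q : ℝ) ^ 2) *
        ∑ n ∈ Ioc A ⌊b⌋₊, ‖a n‖ ^ 2 * (n : ℝ) ^ (-(2 * s.re)) := by
  -- adapted from `Lemma36.moment36_le` (orthogonality ↦ large sieve, real upper endpoint)
  set B : ℕ := ⌊b⌋₊ with hBdef
  set K : ℝ := (B : ℝ) + 1 + 2 * (Q : ℝ) ^ 2 with hKdef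
  set W : ℝ := ∑ n ∈ Ioc A B, ‖a n‖ ^ 2 * (n : ℝ) ^ (-(2 * s.re)) with hWdef
  set L : ℝ := Real.log (b / A) with hLdef
  have ha : (0 : ℝ) < A := Nat.cast_pos.mpr hA
  have hb : (0 : ℝ) < b := ha.trans_le hAb
  have hK : 0 ≤ K := by positivity
  have hW0 : 0 ≤ W := sum_nonneg fun n _ =>
    mul_nonneg (sq_nonneg _) (Real.rpow_nonneg (Nat.cast_nonneg n) _)
  have hL0 : 0 ≤ L := Real.log_nonneg ((one_le_div ha).mpr hAb)
  have hLint : IntervalIntegrable (fun x : ℝ => x⁻¹) volume (A : ℝ) b := by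
    refine intervalIntegral.intervalIntegrable_inv (fun x hx => ?_) continuousOn_id
    rw [Set.uIcc_of_le hAb] at hx
    exact (ha.trans_le hx.1).ne'
  -- (i) the large sieve at every height `N ≤ B`
  have horth : ∀ N, N ≤ B →
      ∑ p ∈ M, ∑ ψ : DirichletCharacter ℂ p with ψ.IsPrimitive, ‖twist36 a A s ψ N‖ ^ 2 ≤
        K * W := by
    intro N hN
    refine (twist36_meanSquare_le_largeSieve a A s N Q M hM).trans ?_
    have hN' : (N : ℝ) + 1 + 2 * (Q : ℝ) ^ 2 ≤ K := by
      rw [hKdef]; gcongr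
    exact mul_le_mul hN' (sum_le_sum_of_subset_of_nonneg (Ioc_subset_Ioc le_rfl hN)
      fun n _ _ => mul_nonneg (sq_nonneg _) (Real.rpow_nonneg (Nat.cast_nonneg n) _)) (sum_nonneg
        fun n _ => mul_nonneg (sq_nonneg _) (Real.rpow_nonneg (Nat.cast_nonneg n) _)) hK
  -- (ii) Cauchy–Schwarz per character
  have hCS : ∀ (p : ℕ) (ψ : DirichletCharacter ℂ p),
      (∫ x in (A : ℝ)..b, ‖twist36 a A s ψ ⌊x⌋₊‖ / x) ^ 2 ≤
        L * ∫ x in (A : ℝ)..b, ‖twist36 a A s ψ ⌊x⌋₊‖ ^ 2 / x := fun p ψ =>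
    sq_integral_div_le_log_mul_integral (fun x => ‖twist36 a A s ψ ⌊x⌋₊‖) ha hAb
      (intervalIntegrable_natFloor_div (fun N => ‖twist36 a A s ψ N‖) ha hAb)
      (intervalIntegrable_natFloor_div (fun N => ‖twist36 a A s ψ N‖ ^ 2) ha hAb)
  -- (iii) the integrated mean square: swap the finite sums with the integral, bound pointwise
  have hint : ∑ p ∈ M, ∑ ψ : DirichletCharacter ℂ p with ψ.IsPrimitive,
      ∫ x in (A : ℝ)..b, ‖twist36 a A s ψ ⌊x⌋₊‖ ^ 2 / x ≤ K * W * L := by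
    have hinner : ∀ p ∈ M, ∑ ψ : DirichletCharacter ℂ p with ψ.IsPrimitive,
        ∫ x in (A : ℝ)..b, ‖twist36 a A s ψ ⌊x⌋₊‖ ^ 2 / x =
          ∫ x in (A : ℝ)..b, (∑ ψ : DirichletCharacter ℂ p with ψ.IsPrimitive,
            ‖twist36 a A s ψ ⌊x⌋₊‖ ^ 2) / x := by
      intro p _
      rw [← intervalIntegral.integral_finsetSum fun ψ _ =>
        intervalIntegrable_natFloor_div (fun N => ‖twist36 a A s ψ N‖ ^ 2) ha hAb]
      simp only [sum_div]
    have houter : ∑ p ∈ M, ∫ x in (A : ℝ)..b, (∑ ψ : DirichletCharacter ℂ p with ψ.IsPrimitive,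
        ‖twist36 a A s ψ ⌊x⌋₊‖ ^ 2) / x =
          ∫ x in (A : ℝ)..b, (∑ p ∈ M, ∑ ψ : DirichletCharacter ℂ p with ψ.IsPrimitive,
            ‖twist36 a A s ψ ⌊x⌋₊‖ ^ 2) / x := by
      rw [← intervalIntegral.integral_finsetSum fun p _ => intervalIntegrable_natFloor_div
        (fun N => ∑ ψ : DirichletCharacter ℂ p with ψ.IsPrimitive, ‖twist36 a A s ψ N‖ ^ 2) ha hAb]
      simp only [sum_div]
    rw [sum_congr rfl hinner, houter]
    calc ∫ x in (A : ℝ)..b, (∑ p ∈ M, ∑ ψ : DirichletCharacter ℂ p with ψ.IsPrimitive,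
          ‖twist36 a A s ψ ⌊x⌋₊‖ ^ 2) / x
        ≤ ∫ x in (A : ℝ)..b, K * W * x⁻¹ := by
          refine intervalIntegral.integral_mono_on hAb (intervalIntegrable_natFloor_div
            (fun N => ∑ p ∈ M, ∑ ψ : DirichletCharacter ℂ p with ψ.IsPrimitive,
              ‖twist36 a A s ψ N‖ ^ 2) ha hAb) (hLint.const_mul _) fun x hx => ?_
          rw [div_eq_mul_inv]
          exact mul_le_mul_of_nonneg_right (horth _ (Nat.floor_le_floor hx.2))
            (inv_nonneg.mpr (ha.trans_le hx.1).le)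
      _ = K * W * L := by
          rw [intervalIntegral.integral_const_mul, integral_inv_of_pos ha hb]
  -- assembly
  calc ∑ p ∈ M, ∑ ψ : DirichletCharacter ℂ p with ψ.IsPrimitive,
        (‖twist36 a A s ψ B‖ + ∫ x in (A : ℝ)..b, ‖twist36 a A s ψ ⌊x⌋₊‖ / x) ^ 2
      ≤ ∑ p ∈ M, ∑ ψ : DirichletCharacter ℂ p with ψ.IsPrimitive,
          (2 * ‖twist36 a A s ψ B‖ ^ 2 +
            2 * L * ∫ x in (A : ℝ)..b, ‖twist36 a A s ψ ⌊x⌋₊‖ ^ 2 / x) := by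
        refine sum_le_sum fun p _ => sum_le_sum fun ψ _ => ?_
        nlinarith [hCS p ψ, sq_nonneg (‖twist36 a A s ψ B‖ -
          ∫ x in (A : ℝ)..b, ‖twist36 a A s ψ ⌊x⌋₊‖ / x)]
    _ = 2 * (∑ p ∈ M, ∑ ψ : DirichletCharacter ℂ p with ψ.IsPrimitive, ‖twist36 a A s ψ B‖ ^ 2) +
          2 * L * ∑ p ∈ M, ∑ ψ : DirichletCharacter ℂ p with ψ.IsPrimitive,
            ∫ x in (A : ℝ)..b, ‖twist36 a A s ψ ⌊x⌋₊‖ ^ 2 / x := by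
        simp only [sum_add_distrib, mul_sum]
    _ ≤ 2 * (K * W) + 2 * L * (K * W * L) :=
        add_le_add (mul_le_mul_of_nonneg_left (horth B le_rfl) zero_le_two)
          (mul_le_mul_of_nonneg_left hint (mul_nonneg zero_le_two hL0))
    _ = (2 + 2 * L ^ 2) * K * W := by ring

/-! ## Layer 2: the sizes of §2 -/

variable {D : ℕ}

/-- `log D ≥ 3` once `D ≥ ⌈e³⌉`. [folklore] -/
private theorem three_le_log_of_le' (hD : ⌈Real.exp 3⌉₊ ≤ D) : 3 ≤ Real.log D := by
  have h : Real.exp 3 ≤ D := le_trans (Nat.le_ceil _) (by exact_mod_cast hD)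
  exact (Real.le_log_iff_exp_le (lt_of_lt_of_le (Real.exp_pos _) h)).mpr h

/-- The window `p ∼ P` lies in `[1, Q]` with `Q = ⌈P(1 + 𝓛⁻⁶⁸)⌉` (the large-sieve level of
Lemma 3.3 (ii)). [cite: Zhang2022LandauSiegel, §2 p. 4] -/
theorem primeWindow_subset_Icc (D : ℕ) :
    primeWindow D ⊆ Icc 1 ⌈bigP D * (1 + (ell D ^ 68)⁻¹)⌉₊ := by
  intro p hp
  simp only [primeWindow, Finset.mem_filter, Finset.mem_Ioo] at hp
  exact Finset.mem_Icc.mpr ⟨hp.2.one_lt.le, hp.1.2.le⟩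

/-- `Q = ⌈P(1 + 𝓛⁻⁶⁸)⌉ ≤ 3P` (as `P ≥ 1`, `𝓛⁻⁶⁸ ≤ 1` for `𝓛 ≥ 1`).
[cite: Zhang2022LandauSiegel, §2 (2.6)] -/
theorem ceil_window_le (hlog : 1 ≤ Real.log D) :
    (⌈bigP D * (1 + (ell D ^ 68)⁻¹)⌉₊ : ℝ) ≤ 3 * bigP D := by
  have hP1 : 1 ≤ bigP D := by
    rw [bigP]; exact Real.one_le_exp (by rw [ell]; positivity)
  have hℓ : (ell D ^ 68)⁻¹ ≤ 1 := by
    rw [ell]; exact inv_le_one_of_one_le₀ (one_le_pow₀ hlog)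
  have h0 : 0 ≤ bigP D * (1 + (ell D ^ 68)⁻¹) := by rw [ell]; positivity
  have h1 := Nat.ceil_lt_add_one h0
  nlinarith [h1, hℓ, hP1, mul_le_mul_of_nonneg_left hℓ (le_trans zero_le_one hP1)]

/-- `P² = exp(2𝓛⁹)` (the range of Lemma 3.1). [cite: Zhang2022LandauSiegel, §2 (2.6)] -/
theorem bigP_sq_eq (D : ℕ) : bigP D ^ 2 = Real.exp (2 * Real.log D ^ 9) := by
  rw [bigP, ell, ← Real.exp_nat_mul]; norm_num

/-- `D⁴ ≤ P²` once `𝓛 ≥ 3` (indeed `D⁸ < p ∼ P`; here directly: `4𝓛 ≤ 2𝓛⁹`).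
[cite: Zhang2022LandauSiegel, §2 (2.6)] -/
theorem pow_four_le_bigP_sq (hlog : 3 ≤ Real.log D) : ((D ^ 4 : ℕ) : ℝ) ≤ bigP D ^ 2 := by
  have hD0 : (0 : ℝ) < D := by
    rcases Nat.eq_zero_or_pos D with h | h
    · subst h; norm_num [Real.log_zero] at hlog
    · exact_mod_cast h
  rw [Nat.cast_pow, bigP_sq_eq]
  have hD4 : (D : ℝ) ^ 4 = Real.exp (4 * Real.log D) := by
    rw [← Real.exp_log hD0, ← Real.exp_nat_mul, Real.log_exp]; norm_num
  rw [hD4, Real.exp_le_exp]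
  have h38 : (3 : ℝ) ^ 8 ≤ Real.log D ^ 8 := pow_le_pow_left₀ (by norm_num) hlog 8
  nlinarith [h38]

/-- **(2.9) in the direction used by Lemma 3.5: `P² ≤ 2𝔓𝓛⁷⁷` for `D` large**, from the tree's
PROVED `frakP_bounds` (`|𝔓 − P²𝓛⁻⁷⁷| ≤ 3𝓛⁻⁶⁸·P²𝓛⁻⁷⁷`, prime number theorem on the window) once
`3𝓛⁻⁶⁸ ≤ 1/2`. [cite: Zhang2022LandauSiegel, §2 (2.9)] -/
theorem bigP_sq_le_frakP : ∃ D₁ : ℕ, ∀ D : ℕ, D₁ ≤ D → 3 ≤ Real.log D →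
    bigP D ^ 2 ≤ 2 * frakP D * Real.log D ^ 77 := by
  obtain ⟨D₁, hD₁⟩ := frakP_bounds
  refine ⟨D₁, fun D hD hlog => ?_⟩
  have h := (abs_le.mp (hD₁ D hD)).1
  set L := Real.log D with hL
  have hL0 : 0 < L := by linarith
  have hP2 : bigP D ^ 2 = Real.exp (L ^ 9) ^ 2 := by rw [bigP, ell]
  rw [hP2]
  set X := Real.exp (L ^ 9) ^ 2 with hX
  have hX0 : 0 ≤ X := by positivity
  have h68 : 3 * (L ^ 68)⁻¹ ≤ 1 / 2 := by
    have h6 : (6 : ℝ) ≤ L ^ 68 := le_trans (by norm_num) (le_trans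
      (pow_le_pow_left₀ (by norm_num) hlog 2) (pow_le_pow_right₀ (by linarith) (by norm_num)))
    rw [show 3 * (L ^ 68)⁻¹ = 3 / L ^ 68 by ring, div_le_iff₀ (by positivity)]
    linarith
  -- `𝔓 ≥ (1 − 3𝓛⁻⁶⁸)·X𝓛⁻⁷⁷ ≥ X𝓛⁻⁷⁷/2`
  have h1 : X * (L ^ 77)⁻¹ / 2 ≤ frakP D := by
    have hY : 0 ≤ X * (L ^ 77)⁻¹ := by positivity
    nlinarith [h, h68, hY]
  have h77 : 0 < L ^ 77 := by positivity
  calc X = (X * (L ^ 77)⁻¹ / 2) * (2 * L ^ 77) := by field_simp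
    _ ≤ frakP D * (2 * L ^ 77) := by gcongr
    _ = 2 * frakP D * L ^ 77 := by ring

/-! ## Layer 3: `X₃`, the left side of (3.5), and the discharge -/

variable (χ : DirichletCharacter ℂ D)

/-- The skeleton's `X₃(y,ψ)` is the tree's twisted partial sum `S(⌊y⌋,ψ)` with coefficients `ν`
cut off below `D⁴`, at `s = s₀`. [cite: Zhang2022LandauSiegel, §3 p. 15] -/
theorem X3_eq_twist36 (x : Chr D) (y : ℝ) :
    X3 χ x y = twist36 (nu χ) (D ^ 4) (s0 D) x.ψ ⌊y⌋₊ := by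
  simp only [X3, twist36]

/-- The left side of (3.5) in the skeleton's encoding, as the tree's twisted sums (the
integration limits `(D:ℝ)⁴ = ↑(D⁴)` and `P²`). [cite: Zhang2022LandauSiegel, §3 (3.5)] -/
theorem lhs35_eq (x : Chr D) :
    ‖X3 χ x (bigP D ^ 2)‖ + ∫ y in (D : ℝ) ^ 4..bigP D ^ 2, ‖X3 χ x y‖ / y =
      ‖twist36 (nu χ) (D ^ 4) (s0 D) x.ψ ⌊bigP D ^ 2⌋₊‖ +
        ∫ y in ((D ^ 4 : ℕ) : ℝ)..bigP D ^ 2, ‖twist36 (nu χ) (D ^ 4) (s0 D) x.ψ ⌊y⌋₊‖ / y := by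
  simp only [X3_eq_twist36, Nat.cast_pow]

/-- **Lemma 3.5 of the manuscript HOLDS** (skeleton node `Skeleton.Lemma35`, DAG node `Z22:Lem3.5`
[Z22 p.15, tex L841], a leaf of `Skeleton.theorem1_of_leaves`): under (A), the inequality (3.5)
fails for at most `C𝔓𝓛⁻⁷³⁹` characters `ψ ∈ Ψ`, `D` large — by the printed route: Lemma 3.1
(`Lemma31.lemma_3_1`) + the large sieve (Lemma 3.3 (ii)) + Cauchy–Schwarz in `dx/x` give the
second moment `≤ 180C₁P²𝓛⁻¹⁹⁹³ ≤ 360C₁𝔓𝓛⁻¹⁹¹⁶` (printed `≪ P²𝓛⁻¹⁹⁹³ ≪ 𝔓𝓛⁻¹⁹⁰⁹`), and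
Chebyshev at `𝓛⁻⁵⁸⁵` leaves `≤ 360C₁𝔓𝓛⁻⁷⁴⁶ ≤ 360C₁𝔓𝓛⁻⁷³⁹` exceptions.
[cite: Zhang2022LandauSiegel, §3 Lemma 3.5] -/
theorem lemma35_holds : Lemma35 := by
  classical
  obtain ⟨C₁, hC₁⟩ := Lemma31.lemma_3_1
  obtain ⟨D₁, hD₁⟩ := bigP_sq_le_frakP
  refine ⟨360 * max C₁ 0, max ⌈Real.exp 3⌉₊ D₁, fun D _ χ hD hq hp hA => ?_⟩
  have hlog : 3 ≤ Real.log D := three_le_log_of_le' (le_trans (le_max_left _ _) hD)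
  have hχ2 : χ ^ 2 = 1 := hq.sq_eq_one
  have hA' : ‖χ.LFunction 1‖ ≤ 1 / Real.log D ^ 2022 := le_of_lt hA
  have hs0 : (s0 D).re = 1 / 2 := by simp [s0, SmoothWeight.s0]
  set L : ℝ := Real.log D with hLdef
  have hL1 : 1 ≤ L := by linarith
  have hL0 : 0 < L := by linarith
  have hLne : L ≠ 0 := hL0.ne'
  set Cm : ℝ := max C₁ 0 with hCm
  have hCm0 : 0 ≤ Cm := le_max_right _ _
  -- the objects
  set A : ℕ := D ^ 4 with hAdef
  set b : ℝ := bigP D ^ 2 with hbdef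
  set Q : ℕ := ⌈bigP D * (1 + (ell D ^ 68)⁻¹)⌉₊ with hQdef
  have hApos : 0 < A := pow_pos (Nat.pos_of_ne_zero (NeZero.ne D)) 4
  have hAb : (A : ℝ) ≤ b := pow_four_le_bigP_sq hlog
  have hP1 : 1 ≤ bigP D := by rw [bigP]; exact Real.one_le_exp (by rw [ell]; positivity)
  have hb1 : 1 ≤ b := one_le_pow₀ hP1
  -- Lemma 3.1 at `N = ⌊P²⌋`: the weight `W ≤ C₁𝓛⁻²⁰¹¹`
  set W : ℝ := ∑ n ∈ Ioc A ⌊b⌋₊, ‖nu χ n‖ ^ 2 * (n : ℝ) ^ (-(2 * (s0 D).re)) with hWdef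
  have hW : W ≤ Cm / L ^ 2011 := by
    have hN : (⌊b⌋₊ : ℝ) ≤ Real.exp (2 * Real.log D ^ 9) := by
      rw [← bigP_sq_eq]; exact Nat.floor_le (by positivity)
    have h31 := hC₁ D χ hp hχ2 hlog hA' ⌊b⌋₊ hN
    have hWeq : W = ∑ n ∈ Ioc A ⌊b⌋₊, ‖divisorSumChar χ n‖ ^ 2 / n := by
      refine sum_congr rfl fun n _ => ?_
      rw [hs0, show -(2 * (1 / 2 : ℝ)) = -1 by norm_num, Real.rpow_neg_one, div_eq_mul_inv]
      rfl
    rw [hWeq]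
    exact h31.trans (div_le_div_of_nonneg_right (le_max_left _ _) (by positivity))
  -- the generic moment bound
  have hmom := moment35_le (nu χ) (s0 D) hApos hAb Q (primeWindow D) (primeWindow_subset_Icc D)
  -- the constants: `2 + 2log²(b/A) ≤ 9𝓛¹⁸`, `⌊b⌋ + 1 + 2Q² ≤ 20P²`
  have hlogc : 2 + 2 * Real.log (b / A) ^ 2 ≤ 9 * L ^ 18 := by
    have ha : (0 : ℝ) < A := Nat.cast_pos.mpr hApos
    have hA1 : (1 : ℝ) ≤ A := by exact_mod_cast hApos
    have hlo : 0 ≤ Real.log (b / A) := Real.log_nonneg ((one_le_div ha).mpr hAb)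
    have hhi : Real.log (b / A) ≤ 2 * L ^ 9 := by
      have h1 : b / A ≤ b := div_le_self (by positivity) hA1
      calc Real.log (b / A) ≤ Real.log b := Real.log_le_log (by positivity) h1
        _ = 2 * L ^ 9 := by rw [hbdef, bigP_sq_eq, Real.log_exp]
    have hsq : Real.log (b / A) ^ 2 ≤ (2 * L ^ 9) ^ 2 := pow_le_pow_left₀ hlo hhi 2
    have h18 : (2 : ℝ) ≤ L ^ 18 := le_trans (by norm_num) (pow_le_pow_left₀ (by norm_num) hlog 18)
    nlinarith [hsq, h18]
  have hKc : (⌊b⌋₊ : ℝ) + 1 + 2 * (Q : ℝ) ^ 2 ≤ 20 * bigP D ^ 2 := by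
    have hfl : (⌊b⌋₊ : ℝ) ≤ b := Nat.floor_le (by positivity)
    have hQ : (Q : ℝ) ≤ 3 * bigP D := ceil_window_le (by rw [← hLdef]; exact hL1)
    have hQ0 : (0 : ℝ) ≤ Q := Nat.cast_nonneg Q
    nlinarith [hfl, hQ, hQ0, hb1, hP1]
  have hW0 : 0 ≤ W := sum_nonneg fun n _ =>
    mul_nonneg (sq_nonneg _) (Real.rpow_nonneg (Nat.cast_nonneg n) _)
  -- the moment: `≤ 9𝓛¹⁸ · 20P² · C₁𝓛⁻²⁰¹¹`
  have hT : ∑ p ∈ primeWindow D, ∑ ψ : DirichletCharacter ℂ p with ψ.IsPrimitive,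
      (‖twist36 (nu χ) A (s0 D) ψ ⌊b⌋₊‖ +
        ∫ x in (A : ℝ)..b, ‖twist36 (nu χ) A (s0 D) ψ ⌊x⌋₊‖ / x) ^ 2 ≤
      9 * L ^ 18 * (20 * bigP D ^ 2) * (Cm / L ^ 2011) := by
    refine hmom.trans ?_
    have h2 : 0 ≤ 2 + 2 * Real.log (b / A) ^ 2 := by positivity
    exact mul_le_mul (mul_le_mul hlogc hKc (by positivity) (by positivity)) hW hW0 (by positivity)
  -- Chebyshev at `V = 𝓛⁻⁵⁸⁵`
  have hV : 0 < (ell D ^ 585)⁻¹ := by rw [ell]; positivity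
  have hcount := sum_card_filter_le_of_moment36 (primeWindow D)
    (fun p ψ => ‖twist36 (nu χ) A (s0 D) ψ ⌊b⌋₊‖ +
      ∫ x in (A : ℝ)..b, ‖twist36 (nu χ) A (s0 D) ψ ⌊x⌋₊‖ / x) hV hT
  -- the exceptional set of the skeleton embeds in the counted family
  set T : Finset ((p : ℕ) × DirichletCharacter ℂ p) := (primeWindow D).sigma fun p =>
    Finset.univ.filter fun ψ : DirichletCharacter ℂ p =>
      ψ.IsPrimitive ∧ (ell D ^ 585)⁻¹ ≤ ‖twist36 (nu χ) A (s0 D) ψ ⌊b⌋₊‖ +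
        ∫ x in (A : ℝ)..b, ‖twist36 (nu χ) A (s0 D) ψ ⌊x⌋₊‖ / x with hTdef
  have hcard : {x : Chr D | ¬ Ineq35 χ x}.ncard ≤ T.card := by
    rw [← Set.ncard_coe_finset]
    refine Set.ncard_le_ncard_of_injOn
      (fun x : Chr D => (⟨x.p, x.ψ⟩ : (p : ℕ) × DirichletCharacter ℂ p)) ?_ ?_
      (Finset.finite_toSet T)
    · intro x hx
      rw [Set.mem_setOf_eq, Ineq35, lhs35_eq, not_lt] at hx
      have hx' : (ell D ^ 585)⁻¹ ≤ ‖twist36 (nu χ) A (s0 D) x.ψ ⌊b⌋₊‖ +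
          ∫ y in (A : ℝ)..b, ‖twist36 (nu χ) A (s0 D) x.ψ ⌊y⌋₊‖ / y := by
        rw [hAdef, hbdef]; exact hx
      rw [Finset.mem_coe, hTdef, Finset.mem_sigma, Finset.mem_filter]
      exact ⟨x.mem, Finset.mem_univ _, x.prim, hx'⟩
    · rintro ⟨p, hp', ψ, hψ⟩ _ ⟨p', hp'', ψ', hψ'⟩ _ h
      simp only [Sigma.mk.injEq] at h
      obtain ⟨rfl, h2⟩ := h
      simp only [heq_eq_eq] at h2
      subst h2
      rfl
  have hTcard : (T.card : ℝ) = ∑ p ∈ primeWindow D, ((Finset.univ.filter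
      fun ψ : DirichletCharacter ℂ p =>
        ψ.IsPrimitive ∧ (ell D ^ 585)⁻¹ ≤ ‖twist36 (nu χ) A (s0 D) ψ ⌊b⌋₊‖ +
          ∫ x in (A : ℝ)..b, ‖twist36 (nu χ) A (s0 D) ψ ⌊x⌋₊‖ / x).card : ℝ) := by
    rw [hTdef, Finset.card_sigma]; push_cast; rfl
  -- `P² ≤ 2𝔓𝓛⁷⁷` and the exponent bookkeeping `18 + 1170 + 77 − 2011 = −746 ≤ −739`
  have hP𝔓 : bigP D ^ 2 ≤ 2 * frakP D * L ^ 77 := hD₁ D (le_trans (le_max_right _ _) hD) hlog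
  have h𝔓0 : 0 ≤ frakP D := by
    rw [frakP_eq_sum_primeWindow]; exact sum_nonneg fun p _ => Nat.cast_nonneg p
  calc (({x : Chr D | ¬ Ineq35 χ x}.ncard : ℕ) : ℝ) ≤ T.card := by exact_mod_cast hcard
    _ = _ := hTcard
    _ ≤ 9 * L ^ 18 * (20 * bigP D ^ 2) * (Cm / L ^ 2011) / ((ell D ^ 585)⁻¹) ^ 2 := hcount
    _ = 180 * Cm * bigP D ^ 2 * (L ^ 18 * L ^ 1170 / L ^ 2011) := by
        rw [ell, ← hLdef]; field_simp; ring
    _ ≤ 180 * Cm * (2 * frakP D * L ^ 77) * (L ^ 18 * L ^ 1170 / L ^ 2011) := by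
        gcongr
    _ = 360 * Cm * frakP D * (L ^ 1265 / L ^ 2011) := by ring
    _ = 360 * Cm * frakP D * (L ^ 746)⁻¹ := by
        rw [show (2011 : ℕ) = 1265 + 746 from rfl, pow_add, div_mul_cancel_left₀ (pow_ne_zero _ hLne)]
    _ ≤ 360 * Cm * frakP D * (L ^ 739)⁻¹ := by
        gcongr 360 * Cm * frakP D * ?_
        exact inv_anti₀ (by positivity) (pow_le_pow_right₀ hL1 (by norm_num))
    _ = 360 * max C₁ 0 * frakP D * (ell D ^ 739)⁻¹ := by rw [hCm, ell, hLdef]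

end Literature.NumberTheory.LFunctions.Zhang2022.Skeleton

end
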